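import Summits.QuantumFields.YangMills.Theorems.BalabanUVNodesN15TwoSpacingGluingNeumannKnitLetters
import Summits.QuantumFields.YangMills.Theorems.BalabanUVNodesN15TwoSpacingGluingRecordKnitEntryZero
import Summits.QuantumFields.YangMills.Theorems.BalabanUVNodesN15TwoSpacingGluingRecordKnitEntryOneDefect
import Summits.QuantumFields.YangMills.Theorems.BalabanUVNodesN15TwoSpacingGluingRecordKnitEntryTwoDefect
import Summits.QuantumFields.YangMills.Theorems.BalabanUVNodesN15TwoSpacingGluingRecordKnitRightDefect
import HarnessLib

/-!
# THE GLUING STEP AT TWO LATTICE SPACINGS, LXXI: FILE 50's FOURTEEN-ROW LETTER BUNDLE FOR THE RECORD COVER's GLUED PAIR ON THE TORUS OF RECORD — `M = L^s` LIVE, VOLUME `m_T` FREE,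
# MODULO THE TWO ENTRY-3 ROWS (dag-n15-c g14, FILE 114 = 92R; N15 = NE2, s1 «background-layer OPERATOR ingredient»)

Cell `pub-ymgap`, seat `pub-ymgap-dag-n15-c` (R134 (a); HUMAN RULING D-0062), generation 14.  `bears_on: R4∕N15 · K3⁸ SpineGivenEndpointR13SepCoPHV (stmt-QuantumFields-27366)`.
Filed `--supports stmt-QuantumFields-27366 --as helper` — COUNT-NEUTRAL.  Theorems only (0 `def`, 0 `sorry`).  Imports BY NAME FILE 92 `…NeumannKnitLetters` (`knitMaj_weaken(₁)`, FILE 50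
`GluedLetters`, `unitTorusGeoS`), FILES 113 ∕ 110 ∕ 112 ∕ 108 (the record rows: `knit_entryZero_rowsR`, `hasMaj_grad_parametrix_knitR` ∕ `hasMaj_idef_grad_parametrix_knitR`,
`hasMaj_parametrix_divAdj_knitR` ∕ `hasMaj_idef_parametrix_divAdj_knitR`, `hasMaj_remainderLR_knit_pair` ∕ `hasMaj_idef_remainderLR_knit`); nothing in the tree is modified.

WHAT.  ★★★ **`gluedLetters_knitR_of_entryThree`** — the record twin of FILE 92 `gluedLetters_knit_of_rightRows`: `d ≥ 1`, odd `L ≥ 3`, `a > 0`.  IF the entry-3 pair of the record cover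
holds (`Δ′∘G̃′ ≤ A e^{−δd}` at every spacing, `𝔇(Δ′G̃′, ΔG̃) ≤ D (L^K)^{−1∕16} e^{−δd}` — dag-n15-w5's 86R∕88R `hasMaj_lap_parametrix_knitR` ∕ `hasMaj_idef_lap_parametrix_knitR`, taken here as the
two BINDERS `hE3`, `hE3d` in FILE 86∕88's literal shapes), THEN there are `δ, γ > 0`, `A, κ₀, m₀, r₀ ≥ 0` with, for all `s`, `m_T ≥ s + 1`, `K ≥ 1` (`4 ≤ L^K`), `r`, `μ`, `ν`,
`GluedLetters blkFine kingPrV G̃ R R̃ ∇_μ Δ ∇*_ν G̃′ R′ R̃′ ∇′_μ Δ′ ∇′*_ν A (κ₀∕L^s) (m₀(L^K)^{−γ}) (r₀(L^K)^{−γ}) δ` over the SIZED carrier `unitTorusGeoS L K (MP (paramsOf d L m_T K hL)) (L^s)` —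
ALL FOURTEEN ROWS of FILE 50's bundle ON THE TORUS OF RECORD with the size parameter `M = L^s` LIVE and the VOLUME `m_T` FREE: rows 1, 5, 6, 9, 13 FILE 113 (91R); 2, 10 FILES 109∕110
(84R∕85R); 3, 11 FILES 111∕112 (89R∕90R); 7, 8, 14 FILES 104∕108 (the right half, no longer a hypothesis); 4, 12 the two binders.

HONEST FRAMING ∕ LIMITS.  Block-majorant bookkeeping over LANDED rows; `U ≡ 1` MODEL of [B6] §2's machine on the torus of record (cube letters from each cube's own doubled torus via programme
P: not circular in the volume); constants crude and ours; nothing of [B5]∕[B6] (2.38)–(2.40)∕[B9] Thm 3.1, 3.14 asserted.  NE2⁺ NOT PRINTED, NOT proved; N15 NOT discharged; counts of record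
UNMOVED (typed 28∕28 · discharged 5∕27); one finite 𝕋⁴ at fixed ε per index — NOT infinite volume, NOT OS on ℝ⁴, NOT a mass gap, NOT Clay; R4 closes `BalabanLadder.UV` only.  Restate-immune.
-/

noncomputable section

namespace Summit.QuantumFields.YangMills.BalabanUVNodes.N15.Gluing

open Real
open Literature.MathematicalPhysics.QuantumFieldTheory.Balaban1983to89
open Literature.MathematicalPhysics.QuantumFieldTheory.Balaban1983to89.B5Prop11Plancherel (Tor fine)
open Literature.MathematicalPhysics.QuantumFieldTheory.Balaban1983to89.B11SectG (BlockNorm HasMaj RowSum)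
open Literature.MathematicalPhysics.QuantumFieldTheory.Balaban1983to89.T4EtaRateDefect (idef)
open Literature.MathematicalPhysics.QuantumFieldTheory.Balaban1983to89.T4EtaRateCoeffDefect (pull)
open Literature.MathematicalPhysics.QuantumFieldTheory.Balaban1983to89.B6UnitTorusCarrier (unitTorusGeo)
open Literature.MathematicalPhysics.QuantumFieldTheory.Balaban1983to89.B5SiteBridgeP12 (MP)
open Literature.MathematicalPhysics.QuantumFieldTheory.King1986.Torus (blockOf tdistT tdistT_nonneg)
open Summit.QuantumFields.YangMills.BalabanUVNodes.N15.VectorPiece (bshiftEquiv kingPrV blkFine blkFine_comp_kingPrV unitTorusGeoS)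
open Summit.QuantumFields.YangMills.BalabanUVNodes.N15.BackgroundLayer (fgrad fgradAdj)
open Summit.QuantumFields.YangMills.BalabanUVNodes.N15.TwoGrid (paramsOf deltaOp)

variable {d : ℕ}

/-! ## The record letter bundle, modulo the entry-3 pair -/

section Bundle

variable {L : ℕ} [NeZero L]

/-- ★★★ **FILE 50's FOURTEEN-ROW LETTER BUNDLE FOR THE RECORD COVER's GLUED PAIR, `M = L^s` LIVE, VOLUME FREE, MODULO THE ENTRY-3 PAIR.**  `d ≥ 1`, odd `L ≥ 3`, `a > 0`.  IF `Δ′∘G̃′ ≤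
A e^{−δd}` (every spacing) and `𝔇(Δ′G̃′, ΔG̃) ≤ D (L^K)^{−1∕16} e^{−δd}` on the record cover (binders `hE3`, `hE3d` — dag-n15-w5's 86R∕88R shapes), THEN `δ, γ > 0`, `A, κ₀, m₀, r₀ ≥ 0` exist with
`GluedLetters … A (κ₀∕L^s) (m₀(L^K)^{−γ}) (r₀(L^K)^{−γ}) δ` over `unitTorusGeoS L K (MP (paramsOf d L m_T K hL)) (L^s)` at every `(s, m_T ≥ s+1, K ≥ 1 (4 ≤ L^K), r, μ, ν)` — rows 1, 5, 6, 9, 13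
FILE 113; 2, 10 FILES 109∕110; 3, 11 FILES 111∕112; 7, 8, 14 FILES 104∕108; 4, 12 the binders; `γ = min(1∕(8(d+1)), γ_L) ≤ 1∕16` for `d ≥ 1`. [cite: Balaban1984PropagatorsII, (2.133)–(2.136)
p.247 (shapes, mechanism); Balaban1985BackgroundPropagators, Thm 3.14 pp.426–427 (difference template); King1986, Prop. 3.9 (3.73) p.665 (rate factor)] -/
theorem gluedLetters_knitR_of_entryThree (hd1 : 1 ≤ d) (hL : Odd L ∧ 1 < L) {a : ℝ} (ha : 0 < a)
    (hE3 : ∃ δ A : ℝ, 0 < δ ∧ 0 < A ∧ ∀ (s mT K r : ℕ) (hs : s + 1 ≤ mT) (_hK : 1 ≤ K),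
      HasMaj (BlockNorm.ofBlocks (unitTorusGeo L K (MP (paramsOf d L mT K hL))) (fun i : Tor (fine (L ^ r * L ^ K) (MP (paramsOf d L mT K hL))) × Fin (d + 1) => blockOf (L ^ r * L ^ K) (MP (paramsOf d L mT K hL)) i.1)) (BlockNorm.ofBlocks (unitTorusGeo L K (MP (paramsOf d L mT K hL))) (fun i : Tor (fine (L ^ r * L ^ K) (MP (paramsOf d L mT K hL))) × Fin (d + 1) => blockOf (L ^ r * L ^ K) (MP (paramsOf d L mT K hL)) i.1))
        (lapOp ((L ^ r * L ^ K : ℕ) : ℝ) (bshiftEquiv (MP (paramsOf d L mT K hL)) (L ^ r * L ^ K)) 0 ∘ₗ parametrix (knitHR d L s mT K (L ^ r * L ^ K) hL) (knitGR d L s mT K (L ^ r * L ^ K) hL hs a))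
        (fun y y' => A * Real.exp (-(δ * tdistT (MP (paramsOf d L mT K hL)) y y'))))
    (hE3d : ∃ δ D : ℝ, 0 < δ ∧ 0 < D ∧ ∀ (s mT K r : ℕ) (hs : s + 1 ≤ mT) (_hK : 1 ≤ K) (_hn4 : 4 ≤ L ^ K),
      HasMaj (BlockNorm.ofBlocks (unitTorusGeo L K (MP (paramsOf d L mT K hL))) (fun b : Tor (fine (L ^ K) (MP (paramsOf d L mT K hL))) × Fin (d + 1) => blockOf (L ^ K) (MP (paramsOf d L mT K hL)) b.1)) (BlockNorm.ofBlocks (unitTorusGeo L K (MP (paramsOf d L mT K hL))) (fun i : Tor (fine (L ^ r * L ^ K) (MP (paramsOf d L mT K hL))) × Fin (d + 1) => blockOf (L ^ r * L ^ K) (MP (paramsOf d L mT K hL)) i.1))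
        (idef (pull (kingPrV L K r (MP (paramsOf d L mT K hL)))) (pull (kingPrV L K r (MP (paramsOf d L mT K hL))))
          (lapOp ((L ^ r * L ^ K : ℕ) : ℝ) (bshiftEquiv (MP (paramsOf d L mT K hL)) (L ^ r * L ^ K)) 0 ∘ₗ parametrix (knitHR d L s mT K (L ^ r * L ^ K) hL) (knitGR d L s mT K (L ^ r * L ^ K) hL hs a))
          (lapOp ((L ^ K : ℕ) : ℝ) (bshiftEquiv (MP (paramsOf d L mT K hL)) (L ^ K)) 0 ∘ₗ parametrix (knitHR d L s mT K (L ^ K) hL) (knitGR d L s mT K (L ^ K) hL hs a)))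
        (fun y y' => D * ((L ^ K : ℕ) : ℝ) ^ (-(1 / 16 : ℝ)) * Real.exp (-(δ * tdistT (MP (paramsOf d L mT K hL)) y y')))) :
    ∃ δ A κ₀ m₀ r₀ γ : ℝ, 0 < δ ∧ 0 ≤ A ∧ 0 ≤ κ₀ ∧ 0 ≤ m₀ ∧ 0 ≤ r₀ ∧ 0 < γ ∧ ∀ (s mT K r : ℕ) (hs : s + 1 ≤ mT) (_hK : 1 ≤ K) (_hn4 : 4 ≤ L ^ K) (μ ν : Fin (d + 1)),
      GluedLetters (g := unitTorusGeoS L K (MP (paramsOf d L mT K hL)) ((L : ℝ) ^ s)) (blkFine L K (MP (paramsOf d L mT K hL))) (kingPrV L K r (MP (paramsOf d L mT K hL)))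
        (parametrix (knitHR d L s mT K (L ^ K) hL) (knitGR d L s mT K (L ^ K) hL hs a)) (remainder (deltaOp (MP (paramsOf d L mT K hL)) (L ^ K) a) (knitHR d L s mT K (L ^ K) hL) (knitGR d L s mT K (L ^ K) hL hs a)) (remainderL (deltaOp (MP (paramsOf d L mT K hL)) (L ^ K) a) (knitHR d L s mT K (L ^ K) hL) (knitGR d L s mT K (L ^ K) hL hs a))
        (fgrad ((L ^ K : ℕ) : ℝ) (bshiftEquiv (MP (paramsOf d L mT K hL)) (L ^ K) μ)) (lapOp ((L ^ K : ℕ) : ℝ) (bshiftEquiv (MP (paramsOf d L mT K hL)) (L ^ K)) 0) (fgradAdj ((L ^ K : ℕ) : ℝ) (bshiftEquiv (MP (paramsOf d L mT K hL)) (L ^ K) ν))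
        (parametrix (knitHR d L s mT K (L ^ r * L ^ K) hL) (knitGR d L s mT K (L ^ r * L ^ K) hL hs a)) (remainder (deltaOp (MP (paramsOf d L mT K hL)) (L ^ r * L ^ K) a) (knitHR d L s mT K (L ^ r * L ^ K) hL) (knitGR d L s mT K (L ^ r * L ^ K) hL hs a)) (remainderL (deltaOp (MP (paramsOf d L mT K hL)) (L ^ r * L ^ K) a) (knitHR d L s mT K (L ^ r * L ^ K) hL) (knitGR d L s mT K (L ^ r * L ^ K) hL hs a))
        (fgrad ((L ^ r * L ^ K : ℕ) : ℝ) (bshiftEquiv (MP (paramsOf d L mT K hL)) (L ^ r * L ^ K) μ)) (lapOp ((L ^ r * L ^ K : ℕ) : ℝ) (bshiftEquiv (MP (paramsOf d L mT K hL)) (L ^ r * L ^ K)) 0) (fgradAdj ((L ^ r * L ^ K : ℕ) : ℝ) (bshiftEquiv (MP (paramsOf d L mT K hL)) (L ^ r * L ^ K) ν))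
        A (κ₀ / (L : ℝ) ^ s) (m₀ * ((L : ℝ) ^ K) ^ (-γ)) (r₀ * ((L : ℝ) ^ K) ^ (-γ)) δ := by
  have hL1 : 1 ≤ L := by have := hL.2; omega
  obtain ⟨δ0, A0, κ0, m0, r0, hδ0, hA0, hκ0, hm0, hr0, H0⟩ := knit_entryZero_rowsR (d := d) hL ha
  obtain ⟨δ1, A1, hδ1, hA1, H1⟩ := hasMaj_grad_parametrix_knitR (d := d) hL ha
  obtain ⟨e1, D1, he1, hD1, H1d⟩ := hasMaj_idef_grad_parametrix_knitR (d := d) hL ha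
  obtain ⟨δ2, A2, hδ2, hA2, H2⟩ := hasMaj_parametrix_divAdj_knitR (d := d) hL ha
  obtain ⟨e2, D2, he2, hD2, H2d⟩ := hasMaj_idef_parametrix_divAdj_knitR (d := d) hd1 hL ha
  obtain ⟨δ3, A3, hδ3, hA3, H3⟩ := hE3
  obtain ⟨e3, D3, he3, hD3, H3d⟩ := hE3d
  obtain ⟨δL, κL, hδL, hκL, HL⟩ := hasMaj_remainderLR_knit_pair (d := d) hL ha
  obtain ⟨eL, rL, γL, heL, hrL, hγL, HLd⟩ := hasMaj_idef_remainderLR_knit (d := d) hL ha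
  -- one rate, one constant per slot
  set δ : ℝ := min (min (min (min δ0 δ1) (min e1 δ2)) (min (min e2 δ3) (min e3 δL))) eL with hδ_def
  have hδ : 0 < δ := lt_min (lt_min (lt_min (lt_min hδ0 hδ1) (lt_min he1 hδ2)) (lt_min (lt_min he2 hδ3) (lt_min he3 hδL))) heL
  have dδ0 : δ ≤ δ0 := (min_le_left _ _).trans ((min_le_left _ _).trans ((min_le_left _ _).trans (min_le_left _ _)))
  have dδ1 : δ ≤ δ1 := (min_le_left _ _).trans ((min_le_left _ _).trans ((min_le_left _ _).trans (min_le_right _ _)))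
  have de1 : δ ≤ e1 := (min_le_left _ _).trans ((min_le_left _ _).trans ((min_le_right _ _).trans (min_le_left _ _)))
  have dδ2 : δ ≤ δ2 := (min_le_left _ _).trans ((min_le_left _ _).trans ((min_le_right _ _).trans (min_le_right _ _)))
  have de2 : δ ≤ e2 := (min_le_left _ _).trans ((min_le_right _ _).trans ((min_le_left _ _).trans (min_le_left _ _)))
  have dδ3 : δ ≤ δ3 := (min_le_left _ _).trans ((min_le_right _ _).trans ((min_le_left _ _).trans (min_le_right _ _)))
  have de3 : δ ≤ e3 := (min_le_left _ _).trans ((min_le_right _ _).trans ((min_le_right _ _).trans (min_le_left _ _)))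
  have dδL : δ ≤ δL := (min_le_left _ _).trans ((min_le_right _ _).trans ((min_le_right _ _).trans (min_le_right _ _)))
  have deL : δ ≤ eL := min_le_right _ _
  set A : ℝ := max (max A0 A1) (max A2 A3) with hA_def
  have aA0 : A0 ≤ A := le_max_of_le_left (le_max_left _ _)
  have aA1 : A1 ≤ A := le_max_of_le_left (le_max_right _ _)
  have aA2 : A2 ≤ A := le_max_of_le_right (le_max_left _ _)
  have aA3 : A3 ≤ A := le_max_of_le_right (le_max_right _ _)
  have hA : 0 ≤ A := hA0.le.trans aA0
  set κ₀ : ℝ := max κ0 κL with hκ₀_def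
  have hκ₀ : 0 ≤ κ₀ := hκ0.trans (le_max_left _ _)
  set m₀ : ℝ := max (max m0 D1) (max D2 D3) with hm₀_def
  have bm0 : m0 ≤ m₀ := le_max_of_le_left (le_max_left _ _)
  have bD1 : D1 ≤ m₀ := le_max_of_le_left (le_max_right _ _)
  have bD2 : D2 ≤ m₀ := le_max_of_le_right (le_max_left _ _)
  have bD3 : D3 ≤ m₀ := le_max_of_le_right (le_max_right _ _)
  have hm₀ : 0 ≤ m₀ := hm0.le.trans bm0
  set r₀ : ℝ := max r0 rL with hr₀_def
  have hr₀ : 0 ≤ r₀ := hr0.le.trans (le_max_left _ _)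
  set γ : ℝ := min (1 / (8 * ((d : ℝ) + 1))) γL with hγ_def
  have hγ : 0 < γ := lt_min (by positivity) hγL
  have hγ8 : γ ≤ 1 / (8 * ((d : ℝ) + 1)) := min_le_left _ _
  have hγL' : γ ≤ γL := min_le_right _ _
  have hγ16 : γ ≤ 1 / 16 := by
    refine hγ8.trans (one_div_le_one_div_of_le (by norm_num) ?_)
    have : (1 : ℝ) ≤ (d : ℝ) := by exact_mod_cast hd1
    linarith
  refine ⟨δ, A, κ₀, m₀, r₀, γ, hδ, hA, hκ₀, hm₀, hr₀, hγ, fun s mT K r hs hK hn4 μ ν => ?_⟩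
  -- the index's numbers
  have hx : (1 : ℝ) ≤ (L : ℝ) ^ K := one_le_pow₀ (by exact_mod_cast hL1)
  have hxm : (0 : ℝ) < (L : ℝ) ^ s := pow_pos (by exact_mod_cast (show 0 < L by omega)) _
  have hθ0 : 0 ≤ ((L : ℝ) ^ K) ^ (-γ) := Real.rpow_nonneg (zero_le_one.trans hx) _
  have hρ16 : ((L ^ K : ℕ) : ℝ) ^ (-(1 / 16 : ℝ)) ≤ ((L : ℝ) ^ K) ^ (-γ) := by
    rw [Nat.cast_pow]; exact Real.rpow_le_rpow_of_exponent_le hx (neg_le_neg hγ16)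
  have hρ8 : ((L ^ K : ℕ) : ℝ) ^ (-(1 / (8 * ((d : ℝ) + 1)))) ≤ ((L : ℝ) ^ K) ^ (-γ) := by
    rw [Nat.cast_pow]; exact Real.rpow_le_rpow_of_exponent_le hx (neg_le_neg hγ8)
  have hρL : ((L : ℝ) ^ K) ^ (-γL) ≤ ((L : ℝ) ^ K) ^ (-γ) := Real.rpow_le_rpow_of_exponent_le hx (neg_le_neg hγL')
  have hρ16_0 : 0 ≤ ((L ^ K : ℕ) : ℝ) ^ (-(1 / 16 : ℝ)) := Real.rpow_nonneg (Nat.cast_nonneg _) _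
  have hρ8_0 : 0 ≤ ((L ^ K : ℕ) : ℝ) ^ (-(1 / (8 * ((d : ℝ) + 1)))) := Real.rpow_nonneg (Nat.cast_nonneg _) _
  have hρL_0 : 0 ≤ ((L : ℝ) ^ K) ^ (-γL) := Real.rpow_nonneg (zero_le_one.trans hx) _
  have hwcast : ((L ^ s : ℕ) : ℝ) = (L : ℝ) ^ s := Nat.cast_pow L s
  have hκw : κ0 / ((L ^ s : ℕ) : ℝ) ≤ κ₀ / (L : ℝ) ^ s := by
    rw [hwcast]; exact div_le_div_of_nonneg_right (le_max_left _ _) hxm.le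
  have hκLw : κL / (L : ℝ) ^ s ≤ κ₀ / (L : ℝ) ^ s := div_le_div_of_nonneg_right (le_max_right _ _) hxm.le
  have hκ₀w : 0 ≤ κ₀ / (L : ℝ) ^ s := div_nonneg hκ₀ hxm.le
  have ht : ∀ y y' : Tor (MP (paramsOf d L mT K hL)), 0 ≤ tdistT (MP (paramsOf d L mT K hL)) y y' := fun y y' => tdistT_nonneg _ _ _
  -- the rows at the index
  obtain ⟨g0, gR, gR', gI0, gIR⟩ := H0 s mT K r hs hK hn4
  have g1 := H1 s mT K r hs hK μ
  have g1d := H1d s mT K r hs hK hn4 μ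
  have g2 := H2 s mT K hs hK ν
  have g2d := H2d s mT K r hs hK hn4 ν
  have g3 := H3 s mT K r hs hK
  have g3d := H3d s mT K r hs hK hn4
  obtain ⟨gL, gL'⟩ := HL s mT K r hs hK
  have gIL := HLd s mT K r hs hK hn4
  -- fine blocks through King's pairing
  have hblk : (fun x : Tor (fine (L ^ r * L ^ K) (MP (paramsOf d L mT K hL))) × Fin (d + 1) => blockOf (L ^ r * L ^ K) (MP (paramsOf d L mT K hL)) x.1) =
      blkFine L K (MP (paramsOf d L mT K hL)) ∘ kingPrV L K r (MP (paramsOf d L mT K hL)) :=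
    (blkFine_comp_kingPrV (M := MP (paramsOf d L mT K hL)) L K r).symm
  rw [hblk] at g0 gR' gI0 gIR g1 g1d g2d g3 g3d gL' gIL
  refine ⟨g0.mono fun y y' => knitMaj_weaken₁ (ht y y') aA0 hA dδ0, g1.mono fun y y' => knitMaj_weaken₁ (ht y y') aA1 hA dδ1,
    g2.mono fun y y' => knitMaj_weaken₁ (ht y y') aA2 hA dδ2, g3.mono fun y y' => knitMaj_weaken₁ (ht y y') aA3 hA dδ3,
    gR.mono fun y y' => knitMaj_weaken₁ (ht y y') hκw hκ₀w dδ0, gR'.mono fun y y' => knitMaj_weaken₁ (ht y y') hκw hκ₀w dδ0,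
    gL.mono fun y y' => knitMaj_weaken₁ (ht y y') hκLw hκ₀w dδL, gL'.mono fun y y' => knitMaj_weaken₁ (ht y y') hκLw hκ₀w dδL,
    gI0.mono fun y y' => knitMaj_weaken (ht y y') bm0 hm₀ hρ16 hρ16_0 dδ0, g1d.mono fun y y' => knitMaj_weaken (ht y y') bD1 hm₀ hρ16 hρ16_0 de1,
    g2d.mono fun y y' => knitMaj_weaken (ht y y') bD2 hm₀ hρ8 hρ8_0 de2, g3d.mono fun y y' => knitMaj_weaken (ht y y') bD3 hm₀ hρ16 hρ16_0 de3,
    gIR.mono fun y y' => knitMaj_weaken (ht y y') (le_max_left _ _) hr₀ hρ16 hρ16_0 dδ0,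
    gIL.mono fun y y' => knitMaj_weaken (ht y y') (le_max_right _ _) hr₀ hρL hρL_0 deL⟩

end Bundle

end Summit.QuantumFields.YangMills.BalabanUVNodes.N15.Gluing

end
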